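import Summits.Ventures.CertifiedManyBodySolver.Observables.StiffnessApexTransportCurtainTargetSlot
import Summits.Ventures.CertifiedManyBodySolver.Observables.StiffnessApexTransportCurtainTop
import HarnessLib

/-!
# Ventures/CertifiedManyBodySolver — Observables/StiffnessApexTransportCurtainTopTargetSlot.lean

HONEST FRAMING: one-sided certified CEILINGS on the uniform flux stiffness (`t–t′` f-sum class) at ANY density, transported into a `(t′, U)` box from
a «curtain» of sources each read at the TARGET's own hopping slot — NO `K₂` input, no lever; a ceiling never speaks to the presence of order; not a
`T_c` estimate, not a superconductivity verdict; every leaf is CONDITIONAL on the families it names. Zero compute, no definition, no `sorry`.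

Cell `pub/hubbard-downfold` (D-0154 (1)(C) COVERAGE, La214 M2(b)/(c) depth «74/5 insurance» / «LSCO x = 1/8»), seat `hubbard-cov-la214-unc-2`
(`prover-hubbard-cov-la214-unc-2-0`). The ANY-DENSITY, LEVER-FREE edition of the two-window curtain and of (E6) «station + SHORT corner overhang + LEFT-EDGE TOP»
of `Observables/StiffnessApexTransportCurtainTop.lean` (this seat, half filling), on the target-slot point engine of `…TargetSlot.lean` and in the idiom of
`…CurtainTargetSlot.lean` (seat hubbard-downfold-unc-2 g15: the target-slot curtain = bottom + left edge `[U_A, U_L]` + overhang AT `U_L`; the «L»). Each family is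
two-parametric — (target slot `σ`, source) — for the objective `−X₀(σ, ·)`; by `orbitLower_slot_chord_of_two_endObjectives` such a family is what TWO ordinary
single-objective bundles (end objectives `−X₀(p)`, `−X₀(q)`) deliver on each curtain piece, each vertex read twice.

* `ObsStiffnessSeqCeilingAt_on_box_of_twoWindowCurtain_targetSlot` — THE TWO-WINDOW TARGET-SLOT CURTAIN (any `0 ≤ n < 2`): BOTTOM family `valB σ s`
  (`s ∈ [p, σ]`, classes at `(s, U_A)`), LEFT₁ family `valL₁ σ U'` (`U' ∈ [U_A, U_L₁]`, classes at `(p, U')`), OVERHANG family `valO σ s` at the height `U_L₁`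
  (`s ∈ [p(2 − U_L₁/U_L₂), p]`), LEFT₂ family `valL₂ σ U'` (`U' ∈ [U_L₂, U_max]`), all for `−X₀(σ, ·)` with `−val ≤ c` ⇒ the whole box `[p, q] × [U_A, U_max]`;
* `ObsStiffnessSeqCeilingAt_on_box_of_apexStation_shortOverhang_and_leftEdgeTop_targetSlot` — (E6) at any density: ONE station `U_A` (bottom family + SHORT
  overhang family `s ∈ [p(2 − U_A/U_L), p]` at `U_A`) + the TOP of the left edge `U' ∈ [U_L, U_max]`; no lever, no `K₂` word, no source left of `p(2 − U_A/U_L)`.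

Doped use (La₂₋ₓSrₓCuO₄ x = 1/8 box `boxLa214E_M15v115`; HgBa₂CuO₄₊δ boxes, where the one-station segment would reach `t′ ≈ −0.865`): the companion
`Downfold/BoxesLa214V115M2cCurtainTop.lean` instantiates (E6) on «La214-E» at `n ∈ [171/200, 179/200]`.

References: T. Koma, H. Tasaki, J. Stat. Phys. 76 (1994) 745, §1 [KomaTasaki1994]; D. J. Scalapino, S. R. White, S.-C. Zhang, PRB 47 (1993)
7995, §II [ScalapinoWhiteZhang1993].
-/

noncomputable section

namespace Summit.Ventures.CertifiedManyBodySolver.Observables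

open Literature.MathematicalPhysics.QuantumLattice
open Literature.MathematicalPhysics.QuantumLattice.ThermodynamicLimit
open Literature.MathematicalPhysics.QuantumFieldTheory
open Literature.Probability.LatticeModels
open Matrix Finset Filter Topology HubbardWave0
open scoped Matrix BigOperators ComplexOrder

section TwoWindow

variable {UA UL₁ UL₂ Umax p q n : ℝ}

/-- **THE TWO-WINDOW TARGET-SLOT CURTAIN (any density, no `K₂` input).** Box `[p, q] × [U_A, U_max]`, `q ≤ 0 < U_A ≤ U_L₁ ≤ U_L₂`, density `0 ≤ n < 2`.
Four two-parameter unconditional orbit-lower families for the objective `−X₀(σ, ·)` at the TARGET slot `σ ∈ [p, q]`: (BOTTOM) `valB σ s` on the classes at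
`(s, U_A)`, `s ∈ [p, σ]`; (LEFT₁) `valL₁ σ U'` on the classes at `(p, U')`, `U' ∈ [U_A, U_L₁]`; (OVERHANG at `U_L₁`) `valO σ s` on the classes at `(s, U_L₁)`,
`s ∈ [p(2 − U_L₁/U_L₂), p]` — a SHORT overhang, enough below `U_L₂`; (LEFT₂) `valL₂ σ U'` on the classes at `(p, U')`, `U' ∈ [U_L₂, U_max]`; with `−val ≤ c` on
their domains. Then `ObsStiffnessSeqCeilingAt t′ U n c` at EVERY point of the box. Below `U_L₂`: the target-slot curtain with `U_max := U_L₂`; above: the apex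
segment of `(t′, U)` meets the bottom inside `[p, t′]`, or the left edge at `U' = U(2 − p/t′)` in one of the two windows, or — strictly between the windows —
the height `U_L₁` inside the short overhang (`leftEdge_height_gt_of_apexSource_lt_shortOverhang` contraposed); every source is read at the slot `σ = t′`
(`ObsStiffnessSeqCeilingAt_of_apexSource_targetSlot_orbitLower`). [cite: KomaTasaki1994, §1] [cite: ScalapinoWhiteZhang1993, §II] -/
theorem ObsStiffnessSeqCeilingAt_on_box_of_twoWindowCurtain_targetSlot (hUA : 0 < UA) (hA1 : UA ≤ UL₁) (h12 : UL₁ ≤ UL₂) (hq : q ≤ 0)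
    (hn0 : 0 ≤ n) (hn2 : n < 2) (valB valL₁ valO valL₂ : ℝ → ℝ → ℝ) (c : ℚ)
    (hB : ∀ σ ∈ Set.Icc p q, ∀ s ∈ Set.Icc p σ,
      ∀ (ω : InfVolFermionState 2) (Ls : ℕ → ℕ) (ψ : ∀ L, Fock (Orb (FermionTorus 2 L))),
      Tendsto Ls atTop atTop →
      (∀ j, IsGroundStateInSector (hubbardTorusTT' (Ls j) 1 s UA) (rectN n (Ls j)) 0 (ψ (Ls j))) →
      (∀ j, star (ψ (Ls j)) ⬝ᵥ ψ (Ls j) = 1) → ω.IsTorusLimitOf ψ Ls →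
      valB σ s ≤ ((Finset.univ : Finset (DihedralGroup 4)).card : ℝ)⁻¹ * ∑ g ∈ (Finset.univ : Finset (DihedralGroup 4)),
        (ω.expect (d4ShiftSet g 0 (box 2 7)) (fermionEmbed (PolySite.d4Emb g 0 (box 2 7)) (-oddMomentObsTT σ UA 0))).re)
    (hcB : ∀ σ ∈ Set.Icc p q, ∀ s ∈ Set.Icc p σ, -valB σ s ≤ ((c : ℚ) : ℝ))
    (hL₁ : ∀ σ ∈ Set.Icc p q, ∀ U' ∈ Set.Icc UA UL₁,
      ∀ (ω : InfVolFermionState 2) (Ls : ℕ → ℕ) (ψ : ∀ L, Fock (Orb (FermionTorus 2 L))),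
      Tendsto Ls atTop atTop →
      (∀ j, IsGroundStateInSector (hubbardTorusTT' (Ls j) 1 p U') (rectN n (Ls j)) 0 (ψ (Ls j))) →
      (∀ j, star (ψ (Ls j)) ⬝ᵥ ψ (Ls j) = 1) → ω.IsTorusLimitOf ψ Ls →
      valL₁ σ U' ≤ ((Finset.univ : Finset (DihedralGroup 4)).card : ℝ)⁻¹ * ∑ g ∈ (Finset.univ : Finset (DihedralGroup 4)),
        (ω.expect (d4ShiftSet g 0 (box 2 7)) (fermionEmbed (PolySite.d4Emb g 0 (box 2 7)) (-oddMomentObsTT σ U' 0))).re)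
    (hcL₁ : ∀ σ ∈ Set.Icc p q, ∀ U' ∈ Set.Icc UA UL₁, -valL₁ σ U' ≤ ((c : ℚ) : ℝ))
    (hO : ∀ σ ∈ Set.Icc p q, ∀ s ∈ Set.Icc (p * (2 - UL₁ / UL₂)) p,
      ∀ (ω : InfVolFermionState 2) (Ls : ℕ → ℕ) (ψ : ∀ L, Fock (Orb (FermionTorus 2 L))),
      Tendsto Ls atTop atTop →
      (∀ j, IsGroundStateInSector (hubbardTorusTT' (Ls j) 1 s UL₁) (rectN n (Ls j)) 0 (ψ (Ls j))) →
      (∀ j, star (ψ (Ls j)) ⬝ᵥ ψ (Ls j) = 1) → ω.IsTorusLimitOf ψ Ls →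
      valO σ s ≤ ((Finset.univ : Finset (DihedralGroup 4)).card : ℝ)⁻¹ * ∑ g ∈ (Finset.univ : Finset (DihedralGroup 4)),
        (ω.expect (d4ShiftSet g 0 (box 2 7)) (fermionEmbed (PolySite.d4Emb g 0 (box 2 7)) (-oddMomentObsTT σ UL₁ 0))).re)
    (hcO : ∀ σ ∈ Set.Icc p q, ∀ s ∈ Set.Icc (p * (2 - UL₁ / UL₂)) p, -valO σ s ≤ ((c : ℚ) : ℝ))
    (hL₂ : ∀ σ ∈ Set.Icc p q, ∀ U' ∈ Set.Icc UL₂ Umax,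
      ∀ (ω : InfVolFermionState 2) (Ls : ℕ → ℕ) (ψ : ∀ L, Fock (Orb (FermionTorus 2 L))),
      Tendsto Ls atTop atTop →
      (∀ j, IsGroundStateInSector (hubbardTorusTT' (Ls j) 1 p U') (rectN n (Ls j)) 0 (ψ (Ls j))) →
      (∀ j, star (ψ (Ls j)) ⬝ᵥ ψ (Ls j) = 1) → ω.IsTorusLimitOf ψ Ls →
      valL₂ σ U' ≤ ((Finset.univ : Finset (DihedralGroup 4)).card : ℝ)⁻¹ * ∑ g ∈ (Finset.univ : Finset (DihedralGroup 4)),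
        (ω.expect (d4ShiftSet g 0 (box 2 7)) (fermionEmbed (PolySite.d4Emb g 0 (box 2 7)) (-oddMomentObsTT σ U' 0))).re)
    (hcL₂ : ∀ σ ∈ Set.Icc p q, ∀ U' ∈ Set.Icc UL₂ Umax, -valL₂ σ U' ≤ ((c : ℚ) : ℝ)) :
    ∀ tp ∈ Set.Icc p q, ∀ U ∈ Set.Icc UA Umax, ObsStiffnessSeqCeilingAt tp U n c := by
  intro tp htp U hU
  rcases le_or_gt U UL₂ with hU2 | hU2
  · -- below the top window: the target-slot curtain on the sub-box `[p, q] × [U_A, U_L₂]`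
    exact ObsStiffnessSeqCeilingAt_on_box_of_curtain_targetSlot (Umax := UL₂) hUA hA1 hq hn0 hn2 valB valL₁ valO c hB hcB hL₁ hcL₁ hO hcO
      tp htp U ⟨hU.1, hU2⟩
  · have hUP : 0 < U := hUA.trans_le hU.1
    have hUne : U ≠ 0 := hUP.ne'
    have htp0 : tp ≤ 0 := htp.2.trans hq
    by_cases hsA : p ≤ tp * (2 * U - UA) / U
    · -- (BOTTOM) source `s = t′(2U − U_A)/U ∈ [p, t′]`, slot `t′`
      have hsle : tp * (2 * U - UA) / U ≤ tp :=
        (apexSource_mem_Icc_of_slab (p := tp) (q := tp) hUA hU.1 hU.2 htp0 ⟨le_rfl, le_rfl⟩).2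
      have hmem : tp * (2 * U - UA) / U ∈ Set.Icc p tp := ⟨hsA, hsle⟩
      have hapexB : U * (tp * (2 * U - UA) / U) = (2 * U - UA) * tp := by
        rw [mul_div_assoc', mul_div_cancel_left₀ _ hUne]; ring
      exact ObsStiffnessSeqCeilingAt_of_apexSource_targetSlot_orbitLower UA (valB tp (tp * (2 * U - UA) / U)) hUA.le hU.1 hUP hapexB
        hn0 hn2 (hB tp htp _ hmem) c (hcB tp htp _ hmem)
    · have hsA : tp * (2 * U - UA) / U < p := not_le.mp hsA
      have ht0 : tp < 0 := by
        rcases htp0.eq_or_lt with h0 | h0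
        · exfalso
          rw [h0, zero_mul, zero_div] at hsA
          exact absurd (htp.1.trans_eq h0) (not_le.2 hsA)
        · exact h0
      have hp0 : p < 0 := lt_of_le_of_lt htp.1 ht0
      obtain ⟨hU'le, hapexL⟩ := leftEdge_apexSource htp.1 ht0 hUP
      have hU'gt : UA < U * (2 - p / tp) := (apexSource_lt_iff_station_lt_leftEdge ht0 hUP).1 hsA
      by_cases h1 : U * (2 - p / tp) ≤ UL₁
      · -- (LEFT₁) source `(p, U')` in the lower window, slot `t′`
        have hmem : U * (2 - p / tp) ∈ Set.Icc UA UL₁ := ⟨hU'gt.le, h1⟩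
        exact ObsStiffnessSeqCeilingAt_of_apexSource_targetSlot_orbitLower (U * (2 - p / tp)) (valL₁ tp (U * (2 - p / tp)))
          (hUA.le.trans hU'gt.le) hU'le hUP hapexL hn0 hn2 (hL₁ tp htp _ hmem) c (hcL₁ tp htp _ hmem)
      · have h1 : UL₁ < U * (2 - p / tp) := not_le.mp h1
        by_cases h2 : UL₂ ≤ U * (2 - p / tp)
        · -- (LEFT₂) source `(p, U')` in the upper window, slot `t′`
          have hmem : U * (2 - p / tp) ∈ Set.Icc UL₂ Umax := ⟨h2, hU'le.trans hU.2⟩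
          exact ObsStiffnessSeqCeilingAt_of_apexSource_targetSlot_orbitLower (U * (2 - p / tp)) (valL₂ tp (U * (2 - p / tp)))
            (hUA.le.trans hU'gt.le) hU'le hUP hapexL hn0 hn2 (hL₂ tp htp _ hmem) c (hcL₂ tp htp _ hmem)
        · -- (OVERHANG at `U_L₁`) the segment passes the height `U_L₁` at `s₁ ∈ [p(2 − U_L₁/U_L₂), p)`, slot `t′`
          have h2 : U * (2 - p / tp) < UL₂ := not_le.mp h2
          have hL1pos : 0 < UL₁ := hUA.trans_le hA1
          have hL1U : UL₁ ≤ U := h12.trans hU2.le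
          have hs1lt : tp * (2 * U - UL₁) / U < p := (apexSource_lt_iff_station_lt_leftEdge ht0 hUP).2 h1
          have hs1ge : p * (2 - UL₁ / UL₂) ≤ tp * (2 * U - UL₁) / U := by
            by_contra hcon
            have hlt := leftEdge_height_gt_of_apexSource_lt_shortOverhang (p := p) ht0 hL1pos h12 hU2.le (not_le.mp hcon)
            exact absurd h2 (not_lt.2 hlt.le)
          have hmem : tp * (2 * U - UL₁) / U ∈ Set.Icc (p * (2 - UL₁ / UL₂)) p := ⟨hs1ge, hs1lt.le⟩
          have hapexO : U * (tp * (2 * U - UL₁) / U) = (2 * U - UL₁) * tp := by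
            rw [mul_div_assoc', mul_div_cancel_left₀ _ hUne]; ring
          exact ObsStiffnessSeqCeilingAt_of_apexSource_targetSlot_orbitLower UL₁ (valO tp (tp * (2 * U - UL₁) / U)) hL1pos.le hL1U hUP
            hapexO hn0 hn2 (hO tp htp _ hmem) c (hcO tp htp _ hmem)

end TwoWindow

section Edition

variable {UA UL Umax p q n : ℝ}

/-- **(E6) AT ANY DENSITY, LEVER-FREE: ONE STATION with a SHORT overhang + the TOP of the left edge.** Box `[p, q] × [U_A, U_max]`, `q ≤ 0 < U_A ≤ U_L`,
`0 ≤ n < 2`: the BOTTOM target-slot family `valB σ s` (`σ ∈ [p,q]`, `s ∈ [p, σ]`, classes at `(s, U_A)`), the SHORT-OVERHANG target-slot family `valO σ s`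
(`σ ∈ [p,q]`, `s ∈ [p(2 − U_A/U_L), p]`, classes at `(s, U_A)`) and the LEFT-TOP target-slot family `valL σ U'` (`σ ∈ [p,q]`, `U' ∈ [U_L, U_max]`, classes at
`(p, U')`), all for `−X₀(σ, ·)` with `−val ≤ c`, give `ObsStiffnessSeqCeilingAt t′ U n c` on the whole box; no source left of `p(2 − U_A/U_L)`, no `K₂` input.
(The two-window target-slot curtain with `U_L₁ := U_A`: the lower window degenerates to the corner `(p, U_A)`, a bottom source.)
[cite: KomaTasaki1994, §1] [cite: ScalapinoWhiteZhang1993, §II] -/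
theorem ObsStiffnessSeqCeilingAt_on_box_of_apexStation_shortOverhang_and_leftEdgeTop_targetSlot (hUA : 0 < UA) (hAL : UA ≤ UL) (hq : q ≤ 0)
    (hn0 : 0 ≤ n) (hn2 : n < 2) (valB valO valL : ℝ → ℝ → ℝ) (c : ℚ)
    (hB : ∀ σ ∈ Set.Icc p q, ∀ s ∈ Set.Icc p σ,
      ∀ (ω : InfVolFermionState 2) (Ls : ℕ → ℕ) (ψ : ∀ L, Fock (Orb (FermionTorus 2 L))),
      Tendsto Ls atTop atTop →
      (∀ j, IsGroundStateInSector (hubbardTorusTT' (Ls j) 1 s UA) (rectN n (Ls j)) 0 (ψ (Ls j))) →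
      (∀ j, star (ψ (Ls j)) ⬝ᵥ ψ (Ls j) = 1) → ω.IsTorusLimitOf ψ Ls →
      valB σ s ≤ ((Finset.univ : Finset (DihedralGroup 4)).card : ℝ)⁻¹ * ∑ g ∈ (Finset.univ : Finset (DihedralGroup 4)),
        (ω.expect (d4ShiftSet g 0 (box 2 7)) (fermionEmbed (PolySite.d4Emb g 0 (box 2 7)) (-oddMomentObsTT σ UA 0))).re)
    (hcB : ∀ σ ∈ Set.Icc p q, ∀ s ∈ Set.Icc p σ, -valB σ s ≤ ((c : ℚ) : ℝ))
    (hO : ∀ σ ∈ Set.Icc p q, ∀ s ∈ Set.Icc (p * (2 - UA / UL)) p,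
      ∀ (ω : InfVolFermionState 2) (Ls : ℕ → ℕ) (ψ : ∀ L, Fock (Orb (FermionTorus 2 L))),
      Tendsto Ls atTop atTop →
      (∀ j, IsGroundStateInSector (hubbardTorusTT' (Ls j) 1 s UA) (rectN n (Ls j)) 0 (ψ (Ls j))) →
      (∀ j, star (ψ (Ls j)) ⬝ᵥ ψ (Ls j) = 1) → ω.IsTorusLimitOf ψ Ls →
      valO σ s ≤ ((Finset.univ : Finset (DihedralGroup 4)).card : ℝ)⁻¹ * ∑ g ∈ (Finset.univ : Finset (DihedralGroup 4)),
        (ω.expect (d4ShiftSet g 0 (box 2 7)) (fermionEmbed (PolySite.d4Emb g 0 (box 2 7)) (-oddMomentObsTT σ UA 0))).re)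
    (hcO : ∀ σ ∈ Set.Icc p q, ∀ s ∈ Set.Icc (p * (2 - UA / UL)) p, -valO σ s ≤ ((c : ℚ) : ℝ))
    (hL : ∀ σ ∈ Set.Icc p q, ∀ U' ∈ Set.Icc UL Umax,
      ∀ (ω : InfVolFermionState 2) (Ls : ℕ → ℕ) (ψ : ∀ L, Fock (Orb (FermionTorus 2 L))),
      Tendsto Ls atTop atTop →
      (∀ j, IsGroundStateInSector (hubbardTorusTT' (Ls j) 1 p U') (rectN n (Ls j)) 0 (ψ (Ls j))) →
      (∀ j, star (ψ (Ls j)) ⬝ᵥ ψ (Ls j) = 1) → ω.IsTorusLimitOf ψ Ls →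
      valL σ U' ≤ ((Finset.univ : Finset (DihedralGroup 4)).card : ℝ)⁻¹ * ∑ g ∈ (Finset.univ : Finset (DihedralGroup 4)),
        (ω.expect (d4ShiftSet g 0 (box 2 7)) (fermionEmbed (PolySite.d4Emb g 0 (box 2 7)) (-oddMomentObsTT σ U' 0))).re)
    (hcL : ∀ σ ∈ Set.Icc p q, ∀ U' ∈ Set.Icc UL Umax, -valL σ U' ≤ ((c : ℚ) : ℝ)) :
    ∀ tp ∈ Set.Icc p q, ∀ U ∈ Set.Icc UA Umax, ObsStiffnessSeqCeilingAt tp U n c := by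
  refine ObsStiffnessSeqCeilingAt_on_box_of_twoWindowCurtain_targetSlot (UL₁ := UA) (UL₂ := UL) hUA le_rfl hAL hq hn0 hn2 valB
    (fun σ _ => valB σ p) valO valL c hB hcB (fun σ hσ U' hU' => ?_) (fun σ hσ U' hU' => ?_) hO hcO hL hcL
  · have hU'A : U' = UA := le_antisymm hU'.2 hU'.1
    subst hU'A
    exact hB σ hσ p ⟨le_rfl, hσ.1⟩
  · exact hcB σ hσ p ⟨le_rfl, hσ.1⟩

end Edition

end Summit.Ventures.CertifiedManyBodySolver.Observables

end
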